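import Summits.BirchSwinnertonDyer.BirchSwinnertonDyer.Theorems.KatoDescentPotSupersingularWildUpperNonsurjNodes
import Summits.BirchSwinnertonDyer.BirchSwinnertonDyer.Theorems.KatoDescentPotSupersingularWildUpperReducibleNodes
import Summits.BirchSwinnertonDyer.BirchSwinnertonDyer.Theorems.KatoDescentPotSupersingularWildFineSelmerCongruenceFact
import HarnessLib

/-!
# Route `KatoDescentPotSupersingular` (rung K9, cell `bsd-potss`): THE U₀ BILL AFTER k9-c4 g3 — the BODY of the
# parent `WildUpperDefectRankZero` (item stmt-BirchSwinnertonDyer-19197) from the route's OTHER nodes, the published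
# inputs, and exactly TWO row-level residues: the reducible defect rows on 3-TORSION CLASSES and ONE CONGRUENT
# Conj-A ANCHOR per irreducible ♯ row; ROUTE-FREE (a `--supports … --as helper` file; seat `bsd-potss-k9-c4` g3;
# nothing booked, BSD is not proved by any of this)

This file only COMPOSES kernel theorems already landed (no new mathematics):
* irreducible, 3-adic tower onto: Kato's A161″ (Tamagawa-exact, Manin-free; `X4RankZero.missingUpperBoundAt_of_katoTam`,
  b2b / kmc) — these rows are defect rows only through `3 ∣ Tam` or a Manin-dirty datum, which A161″ ignores;
* irreducible, tower NOT onto: the re-homed Heegner road (`WildUpperHeegnerRoad.wildUpperNonsurjTower_of_lower_of_rankOne_of_fineSelmerSharp`,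
  k8t-c4 g3 p438322 over k9-c4 g2 p425620): ♭ rows from L₀ (rationality) + the residual `WildRankOne` + Heegner
  cites, CM rows (void) from Burungale–Flach, ♯ non-CM rows from Coates–Sujatha's (A) — and (A) on a ♯ row from
  ONE congruent anchor (Lim–Sujatha 2018 Prop. 3.2 = tree fact p445851; anchors with (A) outright or with finite
  `Sel_{3^∞}(·/ℚ^cyc)[3]`, this seat's p446001/p447140);
* reducible: Kato's member bound M on the 3-torsion-free classes (this seat's p442658), the defect rows on the
  3-torsion classes as the displayed residue `hT`.
So, granted the cite-level inputs, the crux L₀, the crux M and the residual R₁ (all nodes of the route), **the U₀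
parent holds as soon as (i) the reducible defect rows on 3-torsion classes and (ii) one congruent Conj-A anchor
per irreducible tower-deficient ♯ non-CM row are supplied** — `wildUpperDefectRankZero_bill`. This is the exact
residue of item 19197 after this seat (see the FINDING memo on item 19386 for the anchor census: 3Ns 106/116
rows with ordinary partners, 26 unit-certified at data level; 3Nn mostly supersingular-partnered). The term
elaborates against the route decl BY NAME (defeq unfolding; the file imports no `Theses` module). CONDITIONAL
(audit `proof.conditional` on registered facts); item 19197 is NOT closed.

References: [Kato2004Asterisque] Thm. 14.5 (3), Prop. 14.16 (2), Thm. 12.6; [LimSujatha2018] §3 Prop. 3.2;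
[MatarNekovar2019] Thm. 0.3; [GrossZagier1986]; [BumpFriedbergHoffstein1990]; [BurungaleFlach2024] Thm. 1.1;
[Cassels1965ArithmeticVIII]; [GreenbergVatsal2000] Prop. (2.8); [Miller2011LMS] Def. 1.1.
-/

set_option autoImplicit false
-- sibling precedent (`KatoDescentPotSupersingularAssembly.lean`): the directory name repeats the summit name
set_option linter.dupNamespace false

noncomputable section

open scoped Classical

namespace Summit.BirchSwinnertonDyer.BirchSwinnertonDyer.Theorems.WildUpperDefectBill

open WeierstrassCurve Literature.NumberTheory.EllipticCurves
  Literature.NumberTheory.EllipticCurves.ModularForms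
  Literature.NumberTheory.EllipticCurves.Rank1Residual
  Literature.NumberTheory.EllipticCurves.Rank1Residual.Typed
  Summit.BirchSwinnertonDyer.Rank1Residual Summit.BirchSwinnertonDyer.Rank1Residual.Additive
  Summit.BirchSwinnertonDyer.Rank1Residual.O6
  Summit.BirchSwinnertonDyer.BirchSwinnertonDyer.Theorems

/-- **THE U₀ BILL (item 19197) after k9-c4 g3.** Granted the published inputs — Heegner cites (`hGZ`,
`hKo`, `hMN`, `hnf`, `hBFH`), `KatoTamagawaExactInputs` (`hK`: A161″, GZK, modularity),
`PublishedInputsFineSelmerCM` (`hF`: fine-Selmer Kato p420034, Burungale–Flach), Cassels (`hCassels`),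
Lim–Sujatha (`hLS`, p445851) —, the route's crux L₀ (`h₂`, rationality only), residual R₁ (`hR`) and crux M
(`hM`), and the TWO residues: (i) `hT` — the upper half on the reducible defect rows whose isogeny class has a
rational-3-torsion member; (ii) `hcert` — for every irreducible, tower-deficient, ♯ (`3 ∣ ∏c_ℓ` or no
Manin-clean datum), non-CM row, ONE elliptic `W′/ℚ` with `W′[3] ≃ W[3]` carrying (A) at `(W′,3)` or finite
`Sel_{3^∞}(W′/ℚ^cyc)[3]` for every cyclotomic datum: the BODY of `WildUpperDefectRankZero` holds verbatim.
Composition of landed kernel theorems only. Conditional; the item is NOT closed.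
[cite: Kato2004Asterisque, Thm. 14.5 (3) (p. 236), Prop. 14.16 (2) (p. 244), Thm. 12.6 (p. 222)]
[cite: LimSujatha2018, §3 Prop. 3.2] [cite: MatarNekovar2019, Thm. 0.3 (p. 456)] [cite: Miller2011LMS, Def. 1.1] -/
theorem wildUpperDefectRankZero_bill
    (hGZ : ∀ (N : ℕ) [NeZero N] (W : WeierstrassCurve ℚ) (K : Type) [Field K] [NumberField K],
      gross_zagier N W K)
    (hKo : ∀ (N : ℕ) [NeZero N] (W : WeierstrassCurve ℚ) (K : Type) [Field K] [NumberField K],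
      kolyvagin N W K)
    (hMN : ∀ (N : ℕ) [NeZero N] (W : WeierstrassCurve ℚ) (K : Type) [Field K] [NumberField K],
      MatarNekovar2019.thm03_padicValNat_card_sha_le_of_irreducible N W K)
    (hnf : exists_isNewformOf) (hBFH : bumpFriedbergHoffstein_exists_heegnerField_split_twist_simpleZero)
    (hK : Kato2004.rankZero_padicValNat_sha_add_padicValNat_tamagawa_le_of_additive_potGood_of_imageContainsSL2 ∧
      rank_eq_analyticRank_of_analyticRank_le_one ∧ WeierstrassCurve.hasEntireLFunction_rat)
    (hF : Kato2004.rankZero_padicValNat_sha_add_padicValNat_tamagawa_le_of_additive_potGood_of_irreducible_of_fineSelmerDual_fg ∧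
      bsdTriple_of_hasCM_of_L_one_ne_zero)
    (hCassels : bsdRHS_eq_of_isIsogenous)
    (hLS : LimSujatha2018.prop32_fineSelmerDual_moduleFinite_iff_of_torsionIso)
    (h₂ : ∀ (W : WeierstrassCurve ℚ) [W.IsElliptic] [W.IsGloballyMinimal] [Fact (3 : ℕ).Prime],
      W.analyticRank = 0 → ClassO6 W 3 → MissingLowerBoundAt W 3)
    (hR : ∀ (W : WeierstrassCurve ℚ) [W.IsElliptic] [W.IsGloballyMinimal] [Fact (3 : ℕ).Prime],
      W.analyticRank = 1 → ClassO6 W 3 → MissingPPartAt W 3)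
    (hM : O6.KatoMemberShaBoundOfReducible)
    (hT : ∀ (W : WeierstrassCurve ℚ) [W.IsElliptic] [W.IsGloballyMinimal] [Fact (3 : ℕ).Prime],
      W.analyticRank = 0 → ClassO6 W 3 → ¬ W.HasIrreducibleModPGaloisRep 3 →
      ¬ ((∀ (W' : WeierstrassCurve ℚ) [W'.IsElliptic], IsIsogenous W W' → ¬ 3 ^ 2 ∣ W'.torsionOrder) ∧
          ∀ q : ℚ, shaAn W = (q : ℂ) → Even (padicValRat 3 q)) →
      (∃ (W' : WeierstrassCurve ℚ) (_ : W'.IsElliptic), IsIsogenous W W' ∧ 3 ∣ W'.torsionOrder) →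
      MissingUpperBoundAt W 3)
    (hcert : ∀ (W : WeierstrassCurve ℚ) [W.IsElliptic] [W.IsGloballyMinimal] [Fact (3 : ℕ).Prime],
      W.analyticRank = 0 → ClassO6 W 3 → W.HasIrreducibleModPGaloisRep 3 →
      ¬ (∀ n : ℕ, W.HasSurjectiveModNGaloisRep (3 ^ n : ℕ)) →
      (3 ∣ W.tamagawaProduct ∨ ∀ [NeZero (W.conductorNorm ℤ)]
        (D : ModularParametrizationData W (W.conductorNorm ℤ)), (3 : ℤ) ∣ D.maninConstant) →
      ¬ W.HasCM →
      ∃ (W' : WeierstrassCurve ℚ) (_ : W'.IsElliptic), ModPCongruent W' W 3 ∧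
        ((∀ (κ : ZpExtension ℚ 3), κ.IsCyclotomic →
            ∃ (γ : Field.absoluteGaloisGroup ℚ) (D : W'.FineSelmerDualData κ γ),
              Module.Finite ℤ_[3] (RestrictScalars ℤ_[3] (IwasawaAlgebra 3) D.X)) ∨
          ∀ (κ : ZpExtension ℚ 3), κ.IsCyclotomic → Set.Finite {s : W'.selmerInfty κ | 3 • s = 0})) :
    ∀ (W : WeierstrassCurve ℚ) [W.IsElliptic] [W.IsGloballyMinimal] [Fact (3 : ℕ).Prime],
      W.analyticRank = 0 → ClassO6 W 3 →
      ¬ (((∀ n : ℕ, W.HasSurjectiveModNGaloisRep (3 ^ n : ℕ)) ∧ ¬ 3 ∣ W.tamagawaProduct ∧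
            ∃ (N : ℕ) (_ : NeZero N) (D : ModularParametrizationData W N), ¬ (3 : ℤ) ∣ D.maninConstant) ∨
        (¬ W.HasIrreducibleModPGaloisRep 3 ∧
          (∀ (W' : WeierstrassCurve ℚ) [W'.IsElliptic], IsIsogenous W W' → ¬ 3 ^ 2 ∣ W'.torsionOrder) ∧
          ∀ q : ℚ, shaAn W = (q : ℂ) → Even (padicValRat 3 q))) →
      MissingUpperBoundAt W 3 := by
  -- (A) on the ♯ non-CM irreducible tower-deficient rows, from the per-row congruent anchors
  have hCSsharp : ∀ (W : WeierstrassCurve ℚ) [W.IsElliptic] [W.IsGloballyMinimal] [Fact (3 : ℕ).Prime],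
      W.analyticRank = 0 → ClassO6 W 3 → W.HasIrreducibleModPGaloisRep 3 →
      ¬ (∀ n : ℕ, W.HasSurjectiveModNGaloisRep (3 ^ n : ℕ)) →
      (3 ∣ W.tamagawaProduct ∨ ∀ [NeZero (W.conductorNorm ℤ)]
        (D : ModularParametrizationData W (W.conductorNorm ℤ)), (3 : ℤ) ∣ D.maninConstant) →
      ¬ W.HasCM → ∀ (κ : ZpExtension ℚ 3), κ.IsCyclotomic →
        ∃ (γ : Field.absoluteGaloisGroup ℚ) (Df : W.FineSelmerDualData κ γ),
          Module.Finite ℤ_[3] (RestrictScalars ℤ_[3] (IwasawaAlgebra 3) Df.X) := by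
    intro W _ _ _ hr hO hirr hns hsharp hcm κ hκ
    obtain ⟨W', hW', hcong, hA' | hfin'⟩ := hcert W hr hO hirr hns hsharp hcm
    · haveI := hW'
      exact WildFineSelmerCongruenceFact.conjA_of_modPCongruent hLS (by norm_num) hcong hA' κ hκ
    · haveI := hW'
      exact WildFineSelmerCongruenceFact.conjA_of_modPCongruent hLS (by norm_num) hcong
        (WildFineSelmerOrdinaryAnchor.conjA_rat_of_finite_selmerInfty_pTorsion W' hfin') κ hκ
  intro W _ _ _ hr hO hncov
  by_cases hirr : W.HasIrreducibleModPGaloisRep 3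
  · by_cases hsurj : ∀ n : ℕ, W.HasSurjectiveModNGaloisRep (3 ^ n : ℕ)
    · -- irreducible, tower onto: A161″ (Tamagawa-exact, Manin-free)
      exact X4RankZero.missingUpperBoundAt_of_katoTam (W := W) (p := 3) hK.1 hK.2.1 hK.2.2 hr
        ⟨hO.1, hO.2.1, hirr⟩ hO.padicValRat_j_nonneg hsurj
    · -- irreducible, tower not onto: the Heegner road + (A) on the ♯ rows from the anchors
      exact WildUpperHeegnerRoad.wildUpperNonsurjTower_of_lower_of_rankOne_of_fineSelmerSharp hGZ hKo hMN hnf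
        hBFH hK hF h₂ hR hCSsharp W hr hO hirr hsurj
  · -- reducible: Kato's member bound on 3-torsion-free classes, `hT` on the 3-torsion classes
    have hdef : ¬ ((∀ (W' : WeierstrassCurve ℚ) [W'.IsElliptic], IsIsogenous W W' →
        ¬ 3 ^ 2 ∣ W'.torsionOrder) ∧ ∀ q : ℚ, shaAn W = (q : ℂ) → Even (padicValRat 3 q)) :=
      fun h ↦ hncov (Or.inr ⟨hirr, h⟩)
    exact WildUpperReducibleNodes.upperReducibleDefect_of_katoMember_of_torsionClasses hCassels hK.2.1 hK.2.2
      hM hT W hr hO hirr hdef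

end Summit.BirchSwinnertonDyer.BirchSwinnertonDyer.Theorems.WildUpperDefectBill

end
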